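import Summits.NavierStokesRegularity.NavierStokesRegularity.Theorems.TypeICertificateLadderTargetLogisticEnstrophySlab
import Summits.NavierStokesRegularity.NavierStokesRegularity.Theorems.TypeICertificateLadderTargetDepletedEnstrophyDecay
import Literature.Analysis.FluidPDE.NSCriticalClosureTao
import HarnessLib

/-!
# Crux `Target` = `TypeICertificateLadder.NoTypeIBlowup` (stmt-NavierStokesRegularity-1217), line
# `depletion-ladder`: the a-priori LOGISTIC enstrophy bound and the Type-I enstrophy cap

`--supports stmt-NavierStokesRegularity-1217` (line `depletion-ladder`; a-priori form of the
Lamb–energy slack p482516 / slab p484344 along classical Leray–Hopf solutions).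

Along every classical solution of the unforced Navier–Stokes system on `ℝ³ × [0,T)` which is
Leray–Hopf from its rapidly decaying datum (Tao-class sub-slabs `[0, t]`,
`RungReynoldsOne.stub_taoCover`; energy inequality `‖u(t)‖₂² ≤ ‖u₀‖₂²`):

* `frobeniusNormSq_fderiv_le_max_of_sup` — for `0 < t < T` and any bound `|u| ≤ M` on `[0,t] × ℝ³`,
  `‖∇u(t)‖₂² ≤ max (‖∇u₀‖₂², M² ‖u₀‖₂² /(4ν²))`: the enstrophy is slaved QUADRATICALLY to the running
  maximum of the speed (classically: exponentially, `‖∇u₀‖₂² exp(∫₀ᵗ ‖u‖²_∞/(2ν))`);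
* `frobeniusNormSq_fderiv_le_of_rate` — under an eventual rate `√(T−t)‖u(t)‖_∞ ≤ C√ν` (ANY `C`),
  `‖∇u(t)‖₂² ≤ K + C² ‖u₀‖₂² /(4ν(T−t))` near `T`: a Type-I blow-up inflates the enstrophy at most
  like `(T−t)⁻¹`, uniformly in the Type-I constant (the Grönwall bound is `(T−t)^{−C²/2}`,
  `DepletionLadder.lintegral_curl_sq_le_rpow_of_rate` with `κ = 1`).

WHAT THIS IS NOT: no rung — at a blow-up time the `H¹` rate forces `‖∇u(t)‖₂² ≳ (T−t)^{−1/2}`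
(`RungReynoldsOne.stub_h1BlowupRate`), compatible with the cap `(T−t)⁻¹`; the energy is supercritical
and the logistic gain disappears in the Type-I zoom. Elementary. [folklore]

References: Lemarié-Rieusset 2016, Thm. 11.2; Leray 1934 §20; Doering–Gibbon 1995, ch. 5–6.
-/

noncomputable section

open Set Filter Topology MeasureTheory
open scoped RealInnerProductSpace ENNReal NNReal Laplacian ContDiff
open Literature.Analysis.FluidPDE

namespace Summit.NavierStokesRegularity.NavierStokesRegularity.Theorems.DepletionLadder

-- the problem directory repeats the summit name (`NavierStokesRegularity/NavierStokesRegularity`)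
set_option linter.dupNamespace false

open Summit.NavierStokesRegularity.NavierStokesRegularity.Theorems.RungReynoldsOne

/-- `max a (c (E + ε)) ≤ max a (c E) + c ε` for `c, ε ≥ 0`. [folklore] -/
theorem max_mul_add_le (a c E ε : ℝ) (hc : 0 ≤ c) (hε : 0 ≤ ε) :
    max a (c * (E + ε)) ≤ max a (c * E) + c * ε := by
  have hcε : 0 ≤ c * ε := mul_nonneg hc hε
  refine max_le ?_ ?_
  · exact (le_max_left a (c * E)).trans (le_add_of_nonneg_right hcε)
  · rw [mul_add]
    have := le_max_right a (c * E)
    linarith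

/-- **A-priori logistic enstrophy bound.** For a classical solution of the unforced Navier–Stokes
system on `ℝ³ × [0,T)`, Leray–Hopf from its rapidly decaying datum, a time `0 < t < T` and a bound
`|u(s,x)| ≤ M` on `[0,t] × ℝ³`:
`∫ |∇u(t)|²_F ≤ max (∫ |∇u(0)|²_F) (M² · 2E(u₀) /(4ν²))`, `2E(u₀) = ‖u₀‖₂²`.
Proof: Tao-class slab `[0,t]` (`stub_taoCover`), energy inequality
(`IsLerayHopfOn.lintegral_enorm_sq_le`), `frobeniusNormSq_fderiv_le_max_logistic` with
`E₀ = ‖u₀‖₂² + ε`, `ε ↓ 0`. [folklore] -/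
theorem frobeniusNormSq_fderiv_le_max_of_sup {ν T : ℝ} (hν : 0 < ν) (hT : 0 < T)
    {u : ℝ → EuclideanSpace ℝ (Fin 3) → EuclideanSpace ℝ (Fin 3)}
    {p : ℝ → EuclideanSpace ℝ (Fin 3) → ℝ}
    (hsol : IsClassicalNSSolutionOn (Ico 0 T) ν 0 u p) (hLH : IsLerayHopfOn T ν 0 (u 0) u)
    (hdec : HasRapidSpatialDecay (u 0)) {t : ℝ} (ht : t ∈ Ioo 0 T) {M : ℝ}
    (hM : ∀ s ∈ Icc 0 t, ∀ x, ‖u s x‖ ≤ M) :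
    ∫ x, frobeniusNormSq (fderiv ℝ (u t) x) ≤
      max (∫ x, frobeniusNormSq (fderiv ℝ (u 0) x))
        (M ^ 2 * (2 * VectorCalculus.kineticEnergy (u 0)) / (4 * ν ^ 2)) := by
  obtain ⟨q, hsolt, hut, hutt, hpt⟩ := stub_taoCover hν hT hsol hLH hdec ht
  set E₀ : ℝ := 2 * VectorCalculus.kineticEnergy (u 0) with hE₀
  have hE₀0 : 0 ≤ E₀ := mul_nonneg zero_le_two (kineticEnergy_nonneg _)
  -- the energy inequality on the slab, in real form
  obtain ⟨C₀, hC₀⟩ := hut 0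
  have hEs : ∀ s ∈ Icc 0 t, ∫ x, ‖u s x‖ ^ 2 ≤ E₀ := by
    intro s hs
    have hsT : s ∈ Icc 0 T := ⟨hs.1, hs.2.trans ht.2.le⟩
    have cu : Continuous (u s) := (hsolt.contDiff_velocity hs).continuous
    have hlt : ∫⁻ x, ‖u s x‖ₑ ^ 2 < ⊤ :=
      (hLH.lintegral_enorm_sq_le hν.le hsT).trans_lt ENNReal.ofReal_lt_top
    have isq : Integrable (fun x => ‖u s x‖ ^ 2) volume := integrable_sq_norm_of_lintegral_lt_top cu hlt
    have h := hLH.lintegral_enorm_sq_le hν.le hsT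
    rw [← ofReal_integral_sq_norm isq] at h
    exact (ENNReal.ofReal_le_ofReal_iff hE₀0).1 h
  -- the slab bound with `E₀ + ε`, then `ε ↓ 0`
  have hc0 : 0 ≤ M ^ 2 / (4 * ν ^ 2) := by positivity
  have key : ∀ ε : ℝ, 0 < ε → ∫ x, frobeniusNormSq (fderiv ℝ (u t) x) ≤
      max (∫ x, frobeniusNormSq (fderiv ℝ (u 0) x)) (M ^ 2 / (4 * ν ^ 2) * E₀) +
        M ^ 2 / (4 * ν ^ 2) * ε := by
    intro ε hε
    have hpos : 0 < E₀ + ε := by linarith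
    have h := frobeniusNormSq_fderiv_le_max_logistic hν ht.1 hsolt hut hutt hpt hpos hM
      (fun s hs => (hEs s hs).trans (le_add_of_nonneg_right hε.le)) t ⟨ht.1.le, le_rfl⟩
    have hre : M ^ 2 * (E₀ + ε) / (4 * ν ^ 2) = M ^ 2 / (4 * ν ^ 2) * (E₀ + ε) := by ring
    rw [hre] at h
    exact h.trans (max_mul_add_le _ _ _ _ hc0 hε.le)
  have hre' : M ^ 2 * E₀ / (4 * ν ^ 2) = M ^ 2 / (4 * ν ^ 2) * E₀ := by ring
  rw [hre']
  refine le_of_forall_pos_le_add fun δ hδ => ?_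
  -- choose `ε` with `(M²/(4ν²)) ε ≤ δ`
  set c : ℝ := M ^ 2 / (4 * ν ^ 2) with hc
  have h := key (δ / (c + 1)) (by positivity)
  have hcε : c * (δ / (c + 1)) ≤ δ := by
    rw [mul_div_assoc']
    rw [div_le_iff₀ (by positivity)]
    nlinarith
  linarith

/-- **The Type-I enstrophy cap.** Along a classical Leray–Hopf rapidly-decaying-datum solution on
`[0,T)` with eventual rate `√(T−t)‖u(t,x)‖ ≤ C√ν` (any `C`), there are `K` and `t₀ ∈ (0,T)` with
`∫ |∇u(t)|²_F ≤ K + C² · 2E(u₀) /(4ν(T−t))` for all `t ∈ [t₀, T)`: under a Type-I rate the enstrophy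
grows at most like `(T−t)⁻¹`, uniformly in the Type-I constant (Grönwall: `(T−t)^{−C²/2}`). Proof:
`frobeniusNormSq_fderiv_le_max_of_sup` with `M² = B₀² + C²ν/(T−t)`, `B₀` a bound on `[0,t₀]`.
[folklore] -/
theorem frobeniusNormSq_fderiv_le_of_rate {ν T C : ℝ} (hν : 0 < ν) (hT : 0 < T)
    {u : ℝ → EuclideanSpace ℝ (Fin 3) → EuclideanSpace ℝ (Fin 3)}
    {p : ℝ → EuclideanSpace ℝ (Fin 3) → ℝ}
    (hsol : IsClassicalNSSolutionOn (Ico 0 T) ν 0 u p) (hLH : IsLerayHopfOn T ν 0 (u 0) u)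
    (hdec : HasRapidSpatialDecay (u 0))
    (hrate : ∀ᶠ t in 𝓝[<] T, ∀ x, Real.sqrt (T - t) * ‖u t x‖ ≤ C * Real.sqrt ν) :
    ∃ K : ℝ, 0 ≤ K ∧ ∃ t₀ ∈ Ioo 0 T, ∀ t ∈ Ico t₀ T,
      ∫ x, frobeniusNormSq (fderiv ℝ (u t) x) ≤
        K + C ^ 2 * (2 * VectorCalculus.kineticEnergy (u 0)) / (4 * ν * (T - t)) := by
  -- the onset `t₀ ∈ (0, T)` of the rate
  obtain ⟨a, haT, hsub⟩ := mem_nhdsLT_iff_exists_Ioo_subset.1 hrate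
  set t₀ : ℝ := (max a (T / 2) + T) / 2 with ht₀def
  have hmax : max a (T / 2) < T := max_lt haT (by linarith)
  have hat₀ : a < t₀ := by
    have := le_max_left a (T / 2); rw [ht₀def]; linarith
  have ht₀ : t₀ ∈ Ioo 0 T := by
    have := le_max_right a (T / 2); rw [ht₀def]; constructor <;> linarith
  have hrate' : ∀ s ∈ Ico t₀ T, ∀ x, Real.sqrt (T - s) * ‖u s x‖ ≤ C * Real.sqrt ν :=
    fun s hs => hsub ⟨hat₀.trans_le hs.1, hs.2⟩
  -- a sup bound on `[0, t₀]`
  obtain ⟨q₀, hsol₀, hu₀, -, -⟩ := stub_taoCover hν hT hsol hLH hdec ht₀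
  obtain ⟨B₀, hB₀0, hB₀⟩ := exists_forall_norm_le_of_hasBoundedSobolevNormsOn hsol₀ hu₀
  set E₀ : ℝ := 2 * VectorCalculus.kineticEnergy (u 0) with hE₀
  have hE₀0 : 0 ≤ E₀ := mul_nonneg zero_le_two (kineticEnergy_nonneg _)
  set G₀ : ℝ := ∫ x, frobeniusNormSq (fderiv ℝ (u 0) x) with hG₀
  have hG₀0 : 0 ≤ G₀ := integral_nonneg fun x => frobeniusNormSq_nonneg _
  refine ⟨G₀ + B₀ ^ 2 * E₀ / (4 * ν ^ 2), by positivity, t₀, ht₀, fun t ht => ?_⟩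
  have htI : t ∈ Ioo 0 T := ⟨ht₀.1.trans_le ht.1, ht.2⟩
  have hTt : 0 < T - t := sub_pos.2 ht.2
  -- the speed bound on `[0, t]`: `|u|² ≤ B₀² + C²ν/(T−t)`
  set M : ℝ := Real.sqrt (B₀ ^ 2 + C ^ 2 * ν / (T - t)) with hMdef
  have hM2 : M ^ 2 = B₀ ^ 2 + C ^ 2 * ν / (T - t) := Real.sq_sqrt (by positivity)
  have hM : ∀ s ∈ Icc 0 t, ∀ x, ‖u s x‖ ≤ M := by
    intro s hs x
    refine Real.le_sqrt_of_sq_le ?_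
    by_cases hst : s ≤ t₀
    · have h1 : ‖u s x‖ ≤ B₀ := hB₀ s ⟨hs.1, hst⟩ x
      have h2 : 0 ≤ C ^ 2 * ν / (T - t) := by positivity
      nlinarith [norm_nonneg (u s x)]
    · have hsT : s < T := hs.2.trans_lt ht.2
      have h1 := sq_norm_le_of_rate_mul hν.le hsT (hrate' s ⟨(not_le.1 hst).le, hsT⟩ x)
      have hTs : T - t ≤ T - s := by linarith [hs.2]
      have h2 : C ^ 2 * ν / (T - s) ≤ C ^ 2 * ν / (T - t) :=
        div_le_div_of_nonneg_left (by positivity) hTt hTs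
      nlinarith [sq_nonneg B₀]
  have h := frobeniusNormSq_fderiv_le_max_of_sup hν hT hsol hLH hdec htI hM
  rw [hM2] at h
  refine h.trans (max_le ?_ ?_)
  · have : 0 ≤ B₀ ^ 2 * E₀ / (4 * ν ^ 2) + C ^ 2 * E₀ / (4 * ν * (T - t)) := by positivity
    linarith
  · have heq : (B₀ ^ 2 + C ^ 2 * ν / (T - t)) * E₀ / (4 * ν ^ 2) =
        B₀ ^ 2 * E₀ / (4 * ν ^ 2) + C ^ 2 * E₀ / (4 * ν * (T - t)) := by
      field_simp
    rw [heq]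
    linarith

end Summit.NavierStokesRegularity.NavierStokesRegularity.Theorems.DepletionLadder

end
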